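import Summits.Ventures.HodgeRepro.QuadEngine

/-!
# `SumTwo` quadruples of a given pairing pattern and their twist classes — the engine enumeration

Blind re-derivation cell `pub-hodge-repro`, seat `typer` (gen 5).  Continues `QuadEngine.lean` on the
sealer's bit-mask engine.  ROUTE.md §3.4 counts, beyond the census faces (pattern `(4,1,1)`), the
`SumTwo` quadruples of CM types without a conjugate pair of the non-face patterns `(3,2,1)` and
`(2,2,2)` in degree 12 and their twist classes: `960 / 80` for every group and `240 / 22, 28, 38, 22`
(`C₁₂`, `C₆ × C₂`, `D₆`, `Dic₃`) — numbers that were Python-only.  This file makes the enumeration a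
closed computation on any table `Γ`, in the shape of the sealed census (`isSquareOrbitReps`):

* `quadsPat Γ a b` — the quadruples of pattern `(a, b, n/2 − a − b)`, each generated ONCE: from every
  CM type `T` and every ordered partition of `T` into blocks `S₁, S₂, S₃` of sizes `a ≥ b ≥ c`, the
  corners are `T` and `Sᵢ ∪ c·(T ∖ Sᵢ)` (`cornerOf`; the unique completion with `T ∩ Tᵢ = Sᵢ`,
  cf. `FacePattern.lean`), kept iff `T` is the smallest corner, blocks of equal size come in
  increasing order, the four corners are distinct and none is the conjugate of another;
* `quadsValid Γ quads` — every listed quadruple consists of four distinct CM types, is `SumTwo` and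
  has no conjugate pair (kernel re-check, independent of the generator);
* `isQuadOrbitReps Γ quads reps` — every listed quadruple is a twist of some representative, the
  representatives are listed quadruples, and no representative is a twist of another (so the
  representatives are pairwise in different twist classes and `reps.length` is the class count of
  the listed quadruples).

The rows (`QuadOrbits12.lean`) evaluate these by kernel `decide` on the four SEALED tables of
`FaceCensusRows12.lean`.  Completeness of `quadsPat` (every `SumTwo` quadruple without a conjugate pair
of that pattern is generated) is the content of `FacePattern.lean`'s corner equations, not re-proved
here at the mask level; the lower bound «at least `reps.length` classes» needs only `quadsValid` and the
pairwise check.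
-/

set_option autoImplicit false

open Summit.Ventures.HodgeRepro.FaceCensus

namespace HodgeRepro

namespace QuadEngine

variable {n : ℕ}

/-- The mask of a list of embeddings. -/
def maskOfList (L : List (Fin n)) : ℕ := L.foldl (fun acc i => acc ||| bit i) 0

/-- The sublists of a given length. -/
def subsetsOfSize (k : ℕ) (L : List (Fin n)) : List (List (Fin n)) :=
  L.sublists.filter fun s => s.length == k

/-- The corner with shared set `S ⊆ T`: `S ∪ c·(T ∖ S)`. -/
def cornerOf (Γ : CMGaloisType n) (T S : ℕ) : ℕ := S ||| Γ.bar (T ^^^ S)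

/-- Four pairwise distinct masks. -/
def distinctFour (Q : List ℕ) : Bool := Q.eraseDups.length == 4

/-- The quadruples of pattern `(a, b, n/2 − a − b)`, each once (see the module docstring). -/
def quadsPat (Γ : CMGaloisType n) (a b : ℕ) : List (List ℕ) :=
  Γ.cmTypes.flatMap fun T =>
    let L := decode n T
    (subsetsOfSize a L).flatMap fun S₁ =>
      let L₂ := L.filter fun i => !(S₁.contains i)
      (subsetsOfSize b L₂).filterMap fun S₂ =>
        let m₁ := maskOfList S₁
        let m₂ := maskOfList S₂
        let m₃ := (T ^^^ m₁) ^^^ m₂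
        let c := n / 2 - a - b
        let Q := sortNat [T, cornerOf Γ T m₁, cornerOf Γ T m₂, cornerOf Γ T m₃]
        if (Q.head? == some T) && (a != b || m₁ < m₂) && (b != c || m₂ < m₃) && distinctFour Q &&
            !(hasConjPair n Q) then
          some Q
        else none

/-- Independent re-check of a list of quadruples: four distinct CM types, `SumTwo`, no conjugate pair. -/
def quadsValid (Γ : CMGaloisType n) (quads : List (List ℕ)) : Bool :=
  quads.all fun Q => Q.all Γ.isCMType && distinctFour Q && sumTwoMasks n Q && !(hasConjPair n Q)

/-- The twists of a quadruple (normalised). -/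
def twistsOf (Γ : CMGaloisType n) (Q : List ℕ) : List (List ℕ) :=
  (List.finRange n).map fun j => Γ.twistSet j Q

/-- Lexicographic order on lists of naturals (`true` iff `L < M`). -/
def listLt : List ℕ → List ℕ → Bool
  | [], [] => false
  | [], _ :: _ => true
  | _ :: _, [] => false
  | a :: l, b :: m => if a < b then true else if b < a then false else listLt l m

/-- The lexicographically smallest element of a non-empty list (the first one for `[]`). -/
def listMin : List (List ℕ) → List ℕ
  | [] => []
  | L :: Ls => Ls.foldl (fun acc M => if listLt M acc then M else acc) L

/-- The canonical form of a quadruple: the smallest of its twists. -/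
def canonOf (Γ : CMGaloisType n) (Q : List ℕ) : List ℕ := listMin (twistsOf Γ Q)

/-! ### Chunked `all` (the kernel's reduction depth grows with the length of a `List.all`; a list of
960 quadruples exceeds it, 240 does not — so long lists are checked in chunks of `k`). -/

/-- Cut a list into consecutive chunks of length `k` (fuel = the length). -/
def chunksAux {α : Type*} (k : ℕ) : ℕ → List α → List (List α)
  | 0, _ => []
  | _ + 1, [] => []
  | fuel + 1, a :: l => (a :: l).take k :: chunksAux k fuel ((a :: l).drop k)

/-- The chunks of length `k` of a list. -/
def chunks {α : Type*} (k : ℕ) (l : List α) : List (List α) := chunksAux k l.length l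

/-- The chunks reassemble the list (for `0 < k`). -/
theorem flatten_chunksAux {α : Type*} (k : ℕ) (hk : 0 < k) :
    ∀ (fuel : ℕ) (l : List α), l.length ≤ fuel → (chunksAux k fuel l).flatten = l
  | 0, [], _ => rfl
  | 0, _ :: _, h => absurd h (by simp)
  | _ + 1, [], _ => rfl
  | fuel + 1, a :: l, h => by
    rw [chunksAux, List.flatten_cons, flatten_chunksAux k hk fuel _ (by
      rw [List.length_drop]; simp only [List.length_cons] at h ⊢; omega)]
    exact List.take_append_drop k (a :: l)

/-- `all` over the chunks is `all` over the list (for `0 < k`). -/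
theorem all_chunks {α : Type*} (k : ℕ) (hk : 0 < k) (l : List α) (p : α → Bool) :
    ((chunks k l).all fun ch => ch.all p) = l.all p := by
  rw [← List.all_flatten, chunks, flatten_chunksAux k hk l.length l le_rfl]

/-- `all` over a list follows from `all` over each of its chunks (one kernel `decide` per chunk keeps
every theorem inside the default heartbeat budget). -/
theorem all_of_chunks {α : Type*} (m : ℕ) (hm : 0 < m) (l : List α) (p : α → Bool)
    (h : ∀ k, k < (chunks m l).length → ((chunks m l).getD k []).all p = true) : l.all p = true := by
  rw [← all_chunks m hm, List.all_eq_true]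
  intro ch hch
  obtain ⟨k, hk, rfl⟩ := List.mem_iff_getElem.1 hch
  have := h k hk
  rwa [List.getD_eq_getElem _ _ hk] at this

/-- Coverage of the `k`-th chunk (of length `m`) of `quadsPat Γ a b` by the canonical forms `reps`. -/
def coverChunk (Γ : CMGaloisType n) (a b m k : ℕ) (reps : List (List ℕ)) : Bool :=
  ((chunks m (quadsPat Γ a b)).getD k []).all fun Q => reps.contains (canonOf Γ Q)

/-- The representatives are listed quadruples and pairwise not twists of each other. -/
def repsWF (Γ : CMGaloisType n) (quads reps : List (List ℕ)) : Bool :=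
  (reps.all fun R => quads.contains R) &&
    (reps.all fun R => let twR := twistsOf Γ R; reps.all fun R' => R == R' || !(twR.contains R'))

/-- **The class certificate.**  `reps` are the canonical forms of the quadruples of pattern
`(a, b, ·)`: every listed quadruple has its canonical form among `reps`, every representative is a
listed quadruple, and no representative is a twist of another — so the twist classes of the listed
quadruples are in bijection with `reps`. -/
def IsClassReps (Γ : CMGaloisType n) (a b : ℕ) (reps : List (List ℕ)) : Prop :=
  (∀ Q ∈ quadsPat Γ a b, reps.contains (canonOf Γ Q) = true) ∧
    (∀ R ∈ reps, (quadsPat Γ a b).contains R = true) ∧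
      ∀ R ∈ reps, ∀ R' ∈ reps, R = R' ∨ (twistsOf Γ R).contains R' = false

/-- Assembly of the certificate from the per-chunk coverage rows and `repsWF`. -/
theorem isClassReps_of_chunks (Γ : CMGaloisType n) (a b m : ℕ) (hm : 0 < m) (reps : List (List ℕ))
    (hcov : ∀ k, k < (chunks m (quadsPat Γ a b)).length → coverChunk Γ a b m k reps = true)
    (hwf : repsWF Γ (quadsPat Γ a b) reps = true) : IsClassReps Γ a b reps := by
  have h1 := all_of_chunks m hm (quadsPat Γ a b) (fun Q => reps.contains (canonOf Γ Q)) hcov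
  unfold repsWF at hwf
  simp only [Bool.and_eq_true, List.all_eq_true, Bool.or_eq_true, beq_iff_eq, Bool.not_eq_eq_eq_not,
    Bool.not_true] at hwf h1
  exact ⟨h1, hwf.1, hwf.2⟩

/-- `reps` represent the twist classes of `quads`: every listed quadruple is a twist of a representative,
the representatives are listed, and no representative is a twist of another one. -/
def isQuadOrbitReps (Γ : CMGaloisType n) (quads reps : List (List ℕ)) : Bool :=
  let tw := reps.flatMap (twistsOf Γ)
  (quads.all fun Q => tw.contains Q) && (reps.all fun R => quads.contains R) &&
    (reps.all fun R => let twR := twistsOf Γ R; reps.all fun R' => R == R' || !(twR.contains R'))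

end QuadEngine

end HodgeRepro
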